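import Summits.Langlands.Langlands.Theses.NonParallelVoid

/-!
# Sketch — first lemmas of two crux ideas (round 1, ideator k = 2) for
`NonParallelVoid.ResidueParallel` (stmt-Langlands-17003).  Statements only (`sorry`), plus the pure-logic
compositions that are proved.

## Idea `reduction-window-pinning`
At a SPLIT place `v ∣ p` (`F_v = ℚ_p`), `p ≥ 5`, a crystalline `ρ|Γ_{F_v}` with NO invariant line and labelled
gap `n = b − a ≤ p` is `V_{n+1,a_p} ⊗ η` with `v(a_p) > 0`, whose reduction is `ind(ω₂ⁿ) ⊗ η̄`
(Berger–Li–Zhu 2004 Cor. 4.1.2 + Prop. 4.1.3, `(p+1) ∤ n`): ABSOLUTELY IRREDUCIBLE.  Hence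
(A1) `ρ̄` is absolutely irreducible — the "residually reducible supersingular" corner of the residue is EMPTY in
the window; (A2) if `ρ̄|Γ_{F(ζ_p)}` is absolutely reducible, then `ρ̄ ≅ Ind_{F(√p*)}^F χ̄`, so `ρ̄_v ≅ ρ̄_v ⊗ ω^{(p−1)/2}`,
which forces `n ≡ (p+1)/2 (mod p+1)`, i.e. `2n = p + 1`; (A3) at a place with an invariant line the same
self-twist forces `gap ≡ (p−1)/2 (mod p−1)`.  Corollary: two supersingular places in the window ⇒ PARALLEL.

## Idea `empty-weight-bm-saturation`
The commutative algebra of the empty-weight form of Kisin's numerical criterion: FULL support of the patched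
module (Paškūnas' Breuil–Mézard theorem at `F_v = ℚ_p`, every weight and type) + a TORSION specialisation
(Harder: no cusp forms of non-parallel weight at any level) ⇒ the specialised ring has no characteristic-zero
points.
-/

noncomputable section

set_option linter.dupNamespace false

open scoped NumberField
open NumberField IsDedekindDomain Field
open Literature.NumberTheory.GaloisRepresentations Literature.NumberTheory.PAdicHodge

namespace Summit.Langlands.Langlands.Cruxes.ResidueParallel.ReductionWindowPinning

/-- (A1) FIRST LEMMA.  Split `p ≥ 5`, `v ∣ p`, `ρ|Γ_{F_v}` crystalline with no invariant line and every labelled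
gap `≤ p` ⇒ `ρ` is residually absolutely irreducible (over `F` itself).
[cite: BergerLiZhu2004, Cor. 4.1.2 and Prop. 4.1.3] [cite: Breuil2003II, Thm. 1.4 (V ≅ V_{k,a_p} ⊗ η)] -/
theorem residuallyAbsIrreducible_of_supersingular_window :
    ∀ (F : Type) [Field F] [NumberField F] [Algebra.IsQuadraticExtension ℚ F], IsTotallyComplex F →
      ∀ (p : ℕ) [Fact p.Prime], 5 ≤ p →
      ∀ (ρ : FramedGaloisRep F (PadicAlgCl p) 2),
      (∃ v w : HeightOneSpectrum (𝓞 F), v ≠ w ∧ ((p : ℕ) : 𝓞 F) ∈ v.asIdeal ∧ ((p : ℕ) : 𝓞 F) ∈ w.asIdeal) →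
      ∀ (v : HeightOneSpectrum (𝓞 F)) (hv : ((p : ℕ) : 𝓞 F) ∈ v.asIdeal),
      (fontainePstAdicCompletion v p hv).IsCrystallineFramed (ρ.toLocal v) →
      ¬ FramedRep.HasInvariantCompleteFlag (ρ.toLocal v) →
      (letI := (fontainePstAdicCompletion v p hv).algebra
       ∀ τ : v.adicCompletion F →ₐ[ℚ_[p]] PadicAlgCl p, ∃ a b : ℤ, a < b ∧ b - a ≤ (p : ℤ) ∧
         ρ.labelledHodgeTateWeightsAt v (fontainePstAdicCompletion v p hv).algebra
           (fontainePstAdicCompletion v p hv).𝔅 τ.toRingHom = {a, b}) →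
      ρ.IsResiduallyAbsIrreducible := by
  sorry

/-- (A2) PINNING AT A SUPERSINGULAR PLACE.  Same hypotheses + `ρ̄|Γ_{F(ζ_p)}` absolutely reducible ⇒ the gap at
`v` is exactly `(p+1)/2` (stated as `2 (b − a) = p + 1`).  Mechanism: A1 makes `ρ̄` absolutely irreducible, so
`ρ̄ ≅ Ind_K^F χ̄` for the quadratic subextension `K = F(√p*)` of `F(ζ_p)/F`; `v` ramifies in `K`, so
`ρ̄_v ≅ ρ̄_v ⊗ ω^{(p−1)/2}`, and `ind(ω₂ⁿ) ⊗ ω^{(p−1)/2} ≅ ind(ω₂^{n+(p²−1)/2}) ≅ ind(ω₂ⁿ)` iff `n ≡ (p+1)/2 (mod p+1)`.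
[cite: BergerLiZhu2004, Prop. 4.1.3] [cite: DDT1995, §2 (dihedral case of the Taylor–Wiles hypothesis)] -/
theorem twice_gap_eq_of_residuallySmall :
    ∀ (F : Type) [Field F] [NumberField F] [Algebra.IsQuadraticExtension ℚ F], IsTotallyComplex F →
      ∀ (p : ℕ) [Fact p.Prime], 5 ≤ p →
      ∀ (ρ : FramedGaloisRep F (PadicAlgCl p) 2),
      (∃ v w : HeightOneSpectrum (𝓞 F), v ≠ w ∧ ((p : ℕ) : 𝓞 F) ∈ v.asIdeal ∧ ((p : ℕ) : 𝓞 F) ∈ w.asIdeal) →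
      ¬ FramedGaloisRep.IsResiduallyAbsIrreducible (ρ.restrictField (CyclotomicField p F)) →
      ∀ (v : HeightOneSpectrum (𝓞 F)) (hv : ((p : ℕ) : 𝓞 F) ∈ v.asIdeal),
      (fontainePstAdicCompletion v p hv).IsCrystallineFramed (ρ.toLocal v) →
      ¬ FramedRep.HasInvariantCompleteFlag (ρ.toLocal v) →
      (letI := (fontainePstAdicCompletion v p hv).algebra
       ∀ (τ : v.adicCompletion F →ₐ[ℚ_[p]] PadicAlgCl p) (a b : ℤ), a < b → b - a ≤ (p : ℤ) →
         ρ.labelledHodgeTateWeightsAt v (fontainePstAdicCompletion v p hv).algebra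
           (fontainePstAdicCompletion v p hv).𝔅 τ.toRingHom = {a, b} →
         2 * (b - a) = (p : ℤ) + 1) := by
  sorry

/-- (A3) PINNING AT A PLACE WITH AN INVARIANT LINE.  If some OTHER place above `p` is supersingular in the window
(so that A1 applies and `ρ̄` is `p`-dihedral), then at a crystalline place `w ∣ p` where `ρ|Γ_{F_w}` HAS an invariant
line the same self-twist `ρ̄_w ≅ ρ̄_w ⊗ ω^{(p−1)/2}` acts on `ρ̄_w^{ss} = ψ̄₁ ⊕ ψ̄₂` with `ψ̄₁/ψ̄₂|_I = ω^{±gap}`,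
forcing `gap ≡ (p−1)/2 (mod p−1)`: stated as `(p−1) ∣ 2·gap ∧ ¬ (p−1) ∣ gap`. [folklore] -/
theorem gap_mod_of_residuallySmall_flag :
    ∀ (F : Type) [Field F] [NumberField F] [Algebra.IsQuadraticExtension ℚ F], IsTotallyComplex F →
      ∀ (p : ℕ) [Fact p.Prime], 5 ≤ p →
      ∀ (ρ : FramedGaloisRep F (PadicAlgCl p) 2),
      (∃ v w : HeightOneSpectrum (𝓞 F), v ≠ w ∧ ((p : ℕ) : 𝓞 F) ∈ v.asIdeal ∧ ((p : ℕ) : 𝓞 F) ∈ w.asIdeal) →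
      ¬ FramedGaloisRep.IsResiduallyAbsIrreducible (ρ.restrictField (CyclotomicField p F)) →
      -- a supersingular-in-window place `v`:
      (∃ (v : HeightOneSpectrum (𝓞 F)) (hv : ((p : ℕ) : 𝓞 F) ∈ v.asIdeal),
        (fontainePstAdicCompletion v p hv).IsCrystallineFramed (ρ.toLocal v) ∧
        ¬ FramedRep.HasInvariantCompleteFlag (ρ.toLocal v) ∧
        (letI := (fontainePstAdicCompletion v p hv).algebra
         ∀ τ : v.adicCompletion F →ₐ[ℚ_[p]] PadicAlgCl p, ∃ a b : ℤ, a < b ∧ b - a ≤ (p : ℤ) ∧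
           ρ.labelledHodgeTateWeightsAt v (fontainePstAdicCompletion v p hv).algebra
             (fontainePstAdicCompletion v p hv).𝔅 τ.toRingHom = {a, b})) →
      -- the place `w` with an invariant line:
      ∀ (w : HeightOneSpectrum (𝓞 F)) (hw : ((p : ℕ) : 𝓞 F) ∈ w.asIdeal),
      (fontainePstAdicCompletion w p hw).IsCrystallineFramed (ρ.toLocal w) →
      FramedRep.HasInvariantCompleteFlag (ρ.toLocal w) →
      (letI := (fontainePstAdicCompletion w p hw).algebra
       ∀ (τ : w.adicCompletion F →ₐ[ℚ_[p]] PadicAlgCl p) (a b : ℤ), a < b →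
         ρ.labelledHodgeTateWeightsAt w (fontainePstAdicCompletion w p hw).algebra
           (fontainePstAdicCompletion w p hw).𝔅 τ.toRingHom = {a, b} →
         ((p : ℤ) - 1) ∣ 2 * (b - a) ∧ ¬ ((p : ℤ) - 1) ∣ (b - a)) := by
  sorry

/-- COROLLARY (an OUTRIGHT sub-case of the crux, in its own binders): split `p ≥ 5`, crystalline above `p`, every
labelled gap `≤ p`, NO invariant line at ANY place above `p` (both places supersingular), `ρ̄|Γ_{F(ζ_p)}` absolutely
reducible ⇒ the labelled gaps are all `(p+1)/2`, in particular equal.  Pure logic from A2 (proof below, modulo A2). -/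
theorem parallel_of_twoSupersingular_window
    (hA2 : ∀ (F : Type) [Field F] [NumberField F] [Algebra.IsQuadraticExtension ℚ F], IsTotallyComplex F →
      ∀ (p : ℕ) [Fact p.Prime], 5 ≤ p →
      ∀ (ρ : FramedGaloisRep F (PadicAlgCl p) 2),
      (∃ v w : HeightOneSpectrum (𝓞 F), v ≠ w ∧ ((p : ℕ) : 𝓞 F) ∈ v.asIdeal ∧ ((p : ℕ) : 𝓞 F) ∈ w.asIdeal) →
      ¬ FramedGaloisRep.IsResiduallyAbsIrreducible (ρ.restrictField (CyclotomicField p F)) →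
      ∀ (v : HeightOneSpectrum (𝓞 F)) (hv : ((p : ℕ) : 𝓞 F) ∈ v.asIdeal),
      (fontainePstAdicCompletion v p hv).IsCrystallineFramed (ρ.toLocal v) →
      ¬ FramedRep.HasInvariantCompleteFlag (ρ.toLocal v) →
      (letI := (fontainePstAdicCompletion v p hv).algebra
       ∀ (τ : v.adicCompletion F →ₐ[ℚ_[p]] PadicAlgCl p) (a b : ℤ), a < b → b - a ≤ (p : ℤ) →
         ρ.labelledHodgeTateWeightsAt v (fontainePstAdicCompletion v p hv).algebra
           (fontainePstAdicCompletion v p hv).𝔅 τ.toRingHom = {a, b} →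
         2 * (b - a) = (p : ℤ) + 1)) :
    ∀ (F : Type) [Field F] [NumberField F] [Algebra.IsQuadraticExtension ℚ F], IsTotallyComplex F →
      ∀ (p : ℕ) [Fact p.Prime], 5 ≤ p →
      ∀ (ρ : FramedGaloisRep F (PadicAlgCl p) 2),
      (∃ v w : HeightOneSpectrum (𝓞 F), v ≠ w ∧ ((p : ℕ) : 𝓞 F) ∈ v.asIdeal ∧ ((p : ℕ) : 𝓞 F) ∈ w.asIdeal) →
      ¬ FramedGaloisRep.IsResiduallyAbsIrreducible (ρ.restrictField (CyclotomicField p F)) →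
      (∀ (v : HeightOneSpectrum (𝓞 F)) (hv : ((p : ℕ) : 𝓞 F) ∈ v.asIdeal),
        (fontainePstAdicCompletion v p hv).IsCrystallineFramed (ρ.toLocal v)) →
      (∀ v : HeightOneSpectrum (𝓞 F), ((p : ℕ) : 𝓞 F) ∈ v.asIdeal →
        ¬ FramedRep.HasInvariantCompleteFlag (ρ.toLocal v)) →
      (∀ (v : HeightOneSpectrum (𝓞 F)) (hv : ((p : ℕ) : 𝓞 F) ∈ v.asIdeal),
        letI := (fontainePstAdicCompletion v p hv).algebra
        ∀ τ : v.adicCompletion F →ₐ[ℚ_[p]] PadicAlgCl p, ∃ a b : ℤ, a < b ∧ b - a ≤ (p : ℤ) ∧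
          ρ.labelledHodgeTateWeightsAt v (fontainePstAdicCompletion v p hv).algebra
            (fontainePstAdicCompletion v p hv).𝔅 τ.toRingHom = {a, b}) →
      ∃ g : ℤ, ∀ (v : HeightOneSpectrum (𝓞 F)) (hv : ((p : ℕ) : 𝓞 F) ∈ v.asIdeal),
        letI := (fontainePstAdicCompletion v p hv).algebra
        ∀ τ : v.adicCompletion F →ₐ[ℚ_[p]] PadicAlgCl p, ∃ a : ℤ,
          ρ.labelledHodgeTateWeightsAt v (fontainePstAdicCompletion v p hv).algebra
            (fontainePstAdicCompletion v p hv).𝔅 τ.toRingHom = {a, a + g} := by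
  intro F _ _ _ hF p _ hp ρ hsplit hsmall hcrys hss hHT
  -- `p` is odd, so `g := (p + 1) / 2` satisfies `2 g = p + 1` in `ℤ`.
  have hp2 : (p : ℤ) % 2 = 1 := by
    have hodd : Odd p := (Fact.out : p.Prime).odd_of_ne_two (by omega)
    obtain ⟨k, hk⟩ := hodd
    omega
  refine ⟨((p : ℤ) + 1) / 2, fun v hv => ?_⟩
  intro τ
  obtain ⟨a, b, hab, hwin, hHTv⟩ := hHT v hv τ
  have h2 := hA2 F hF p hp ρ hsplit hsmall v hv (hcrys v hv) (hss v hv) τ a b hab hwin hHTv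
  refine ⟨a, ?_⟩
  have hb : b = a + ((p : ℤ) + 1) / 2 := by omega
  rw [hHTv, hb]

end Summit.Langlands.Langlands.Cruxes.ResidueParallel.ReductionWindowPinning

namespace Summit.Langlands.Langlands.Cruxes.ResidueParallel.EmptyWeightSaturation

/-- FIRST LEMMA (pure commutative algebra; the empty-weight form of Kisin's numerical criterion).  Let `M` be a
finite module over a Noetherian ring `R` with FULL support (`Ann_R M = 0`: at `F_v = ℚ_p` this is the output of
the numerical Breuil–Mézard criterion `Literature.Barriers.Langlands.PatchingLocalComponentBarrierNarrow` /
Paškūnas' theorem, for every weight and type), `𝔞 ⊴ R` (the augmentation ideal of the patching variables) and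
`ϖ ∈ R` (the image of `p`).  If the specialisation `M/𝔞M` is `ϖ`-power torsion (Harder: the cohomology of the
Bianchi manifold in a NON-parallel weight is torsion at every level and type), then EVERY ring homomorphism from
`R/𝔞` to a field kills `ϖ`: the specialised deformation ring `R_∞(λ,τ)/𝔞 ↠ R^{λ,τ}_{ρ̄,S}` has no point in
characteristic `0`, i.e. no `ρ` of that weight and type exists.  Proof sketch: the kernel `𝔮 ⊇ 𝔞` of
`R → R/𝔞 → K` is a prime in `Supp M = V(Ann M) = Spec R`; Nakayama gives `(M/𝔞M)_𝔮 ≠ 0`, so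
`ϖ^N ∈ Ann(M/𝔞M) ⊆ 𝔮`.  The PROOF below runs the determinant trick instead (Cayley–Hamilton for the endomorphism
`ϖ^N` whose range lies in `𝔞M`): some monic `q` with lower coefficients in `𝔞` has `q(ϖ^N) ∈ Ann M = 0`, so
`ϖ^{N·deg q} ∈ 𝔞`.  (Noetherianity is not even needed.)
[cite: Kisin2009FM, Lemma (2.2.11)] [cite: GeeNewton2022, Cor. 5.1.? (cor: modularity lifting) and Rem. 5.1.? (FM)] -/
theorem map_eq_zero_of_fullSupport_of_torsion_specialisation
    {R : Type*} [CommRing R] {M : Type*} [AddCommGroup M] [Module R M]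
    [Module.Finite R M] (hfull : Module.annihilator R M = ⊥)
    (𝔞 : Ideal R) (ϖ : R) (N : ℕ)
    (htors : ∀ m : M, (ϖ ^ N) • m ∈ 𝔞 • (⊤ : Submodule R M))
    (hM : Nontrivial M) :
    ∀ (K : Type*) [Field K] (x : R ⧸ 𝔞 →+* K), x (Ideal.Quotient.mk 𝔞 ϖ) = 0 := by
  intro K _ x
  -- the endomorphism `ϖ^N` has range in `𝔞 • M`
  set f : Module.End R M := algebraMap R (Module.End R M) (ϖ ^ N) with hf
  have hrange : LinearMap.range f ≤ 𝔞 • (⊤ : Submodule R M) := by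
    rintro y ⟨m, rfl⟩
    rw [hf, Module.algebraMap_end_apply]
    exact htors m
  obtain ⟨q, hmonic, -, hcoeff, haeval⟩ :=
    LinearMap.exists_monic_and_natDegree_eq_and_coeff_mem_pow_and_aeval_eq_zero R f 𝔞 hrange
  -- `q(ϖ^N)` annihilates `M`, hence vanishes
  have heval : Polynomial.eval (ϖ ^ N) q = 0 := by
    have hmem : Polynomial.eval (ϖ ^ N) q ∈ Module.annihilator R M := by
      rw [Module.mem_annihilator]
      intro m
      have h1 := LinearMap.congr_fun haeval m
      rw [hf, Polynomial.aeval_algebraMap_apply_eq_algebraMap_eval, Module.algebraMap_end_apply] at h1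
      simpa using h1
    rw [hfull] at hmem
    simpa using hmem
  -- the degree of `q` is positive (else `q = 1` kills a non-trivial module)
  have hnpos : q.natDegree ≠ 0 := by
    intro h0
    have hq1 : q = 1 := Polynomial.eq_one_of_monic_natDegree_zero hmonic h0
    rw [hq1] at haeval
    simp at haeval
  -- lower coefficients lie in `𝔞`, so `(ϖ^N)^n ∈ 𝔞`
  have hsum : (∑ i ∈ Finset.range q.natDegree, q.coeff i * (ϖ ^ N) ^ i) ∈ 𝔞 := by
    refine Ideal.sum_mem _ (fun i hi => Ideal.mul_mem_right _ _ ?_)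
    have hi' : i < q.natDegree := Finset.mem_range.mp hi
    exact Ideal.pow_le_self (by omega) (hcoeff i)
  have hpow : (ϖ ^ N) ^ q.natDegree ∈ 𝔞 := by
    have hexp : Polynomial.eval (ϖ ^ N) q =
        (ϖ ^ N) ^ q.natDegree + ∑ i ∈ Finset.range q.natDegree, q.coeff i * (ϖ ^ N) ^ i := by
      conv_lhs => rw [hmonic.as_sum]
      simp [Polynomial.eval_finsetSum]
    have hneg : (ϖ ^ N) ^ q.natDegree = -(∑ i ∈ Finset.range q.natDegree, q.coeff i * (ϖ ^ N) ^ i) := by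
      have := heval; rw [hexp] at this; linear_combination this
    rw [hneg]
    exact 𝔞.neg_mem hsum
  -- read it off in `K`
  have hzero : (Ideal.Quotient.mk 𝔞 ϖ) ^ (N * q.natDegree) = 0 := by
    rw [pow_mul, ← map_pow, ← map_pow]
    exact Ideal.Quotient.eq_zero_iff_mem.mpr hpow
  have hx : (x (Ideal.Quotient.mk 𝔞 ϖ)) ^ (N * q.natDegree) = 0 := by
    rw [← map_pow, hzero, map_zero]
  rcases Nat.eq_zero_or_pos (N * q.natDegree) with h0 | hpos
  · rw [h0, pow_zero] at hx
    exact absurd hx one_ne_zero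
  · exact pow_eq_zero_iff (Nat.pos_iff_ne_zero.mp hpos) |>.mp hx

/-- The CELL of the crux this line is pointed at (typed in the crux's binders): split `p ≥ 7`, `ρ̄|Γ_{F(ζ_p)}`
absolutely irreducible, NOT crystalline at some place above `p` (a genuine potentially semistable type), no
invariant line somewhere ⇒ parallel.  (Inside `ResidueParallel`: `¬G` holds through its crystalline conjunct.) -/
theorem typesCell_split_bigImage :
    ∀ (F : Type) [Field F] [NumberField F] [Algebra.IsQuadraticExtension ℚ F], IsTotallyComplex F →
      ∀ (p : ℕ) [Fact p.Prime], 7 ≤ p →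
      ∀ (ρ : FramedGaloisRep F (PadicAlgCl p) 2), ρ.toGaloisRep.IsIrreducible →
      (∀ᶠ v : HeightOneSpectrum (𝓞 F) in Filter.cofinite, ρ.IsUnramifiedAt v) →
      (∀ (v : HeightOneSpectrum (𝓞 F)) (hv : ((p : ℕ) : 𝓞 F) ∈ v.asIdeal),
        (fontainePstAdicCompletion v p hv).IsDeRhamFramed (ρ.toLocal v) ∧
        (letI := (fontainePstAdicCompletion v p hv).algebra
         ∀ τ : v.adicCompletion F →ₐ[ℚ_[p]] PadicAlgCl p, ∃ a b : ℤ, a < b ∧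
           ρ.labelledHodgeTateWeightsAt v (fontainePstAdicCompletion v p hv).algebra
             (fontainePstAdicCompletion v p hv).𝔅 τ.toRingHom = {a, b})) →
      ¬ (∀ v : HeightOneSpectrum (𝓞 F), ((p : ℕ) : 𝓞 F) ∈ v.asIdeal →
        FramedRep.HasInvariantCompleteFlag (ρ.toLocal v)) →
      (∃ v w : HeightOneSpectrum (𝓞 F), v ≠ w ∧ ((p : ℕ) : 𝓞 F) ∈ v.asIdeal ∧ ((p : ℕ) : 𝓞 F) ∈ w.asIdeal) →
      FramedGaloisRep.IsResiduallyAbsIrreducible (ρ.restrictField (CyclotomicField p F)) →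
      ¬ (∀ (v : HeightOneSpectrum (𝓞 F)) (hv : ((p : ℕ) : 𝓞 F) ∈ v.asIdeal),
        (fontainePstAdicCompletion v p hv).IsCrystallineFramed (ρ.toLocal v)) →
      ∃ g : ℤ, ∀ (v : HeightOneSpectrum (𝓞 F)) (hv : ((p : ℕ) : 𝓞 F) ∈ v.asIdeal),
        letI := (fontainePstAdicCompletion v p hv).algebra
        ∀ τ : v.adicCompletion F →ₐ[ℚ_[p]] PadicAlgCl p, ∃ a : ℤ,
          ρ.labelledHodgeTateWeightsAt v (fontainePstAdicCompletion v p hv).algebra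
            (fontainePstAdicCompletion v p hv).𝔅 τ.toRingHom = {a, a + g} := by
  sorry

end Summit.Langlands.Langlands.Cruxes.ResidueParallel.EmptyWeightSaturation
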